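import Summits.BirchSwinnertonDyer.Rank1Residual.Iwasawa.DatumSelmerLocalIndexFinite
import Literature.NumberTheory.EllipticCurves.ZpCorankQuasiIso
import Literature.NumberTheory.EllipticCurves.SelmerCorankProofs
import Mathlib.LinearAlgebra.Pi
import Mathlib.Data.Fintype.Option
import HarnessLib

/-!
# `corank_{ℤ_p}(S^{Σ₀}_A(K_∞)/S_A(K_∞)) ≤ Σ_{v∈Σ₀} N_v · c_v` from PER-PLACE corank bounds
# (the embedding `S^{Σ₀}/S ↪ ∏_{v∈Σ₀} ∏_{n<N_v} H¹(I_η, E[p^∞])`, Greenberg–Vatsal §2 p. 20) — cell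
# `b2b-bsdres`, unit `b2b-bsdres-eisenstein-p2`, gen 30, programme P1 (UPPER HALF of Cor. (2.3))

HONEST FRAMING (run/shared/lean/b2b/bsd-rank1-residual/, verbatim in every file): the goal of the
cell is to DELETE the COMBINATION-SHAPED residual classes of the Birch–Swinnerton-Dyer formula for
ALL analytic-rank `≤ 1` elliptic curves over `ℚ` — "full BSD formula for every rank `≤ 1` curve in
class `C`" assembled STRICTLY from published theorems — so that the rank-`≤ 1` remainder becomes
exactly the CONSTRUCTION-SHAPED classes, which are TYPED (missing-input `Prop`s), NOT attempted.
This is not "finishing BSD". Research route; NO CLAIM BEYOND STATED CLASSES; nothing here changes a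
label. Theorems only; no definition, no named fact, no `sorry`.

WHAT. For a number field `K`, `E/K` elliptic, a prime `p`, a `ℤ_p`-extension `κ` (`H = ker κ`) with
topological generator `γ`, ANY Greenberg data `L` for `A = E[p^∞]`, and a finite set `S₀` of places
`v ∤ p`, write `S^{S₀} = datumSelmerInfty κ A L ↑S₀ ⊇ S = datumSelmerInfty κ A L ∅`. Given, at each
`v ∈ S₀`, (a) a number `N_v` of `γ`-translates representing the places of `K_∞` above `v`
(`hrep : Γ_K = H · D_v · {γⁿ : n < N_v}`, team n1011's `exists_forall_eq_mul_decomp_mul_pow`), and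
(b) a bound `c_v` on the `ℤ_p`-corank of every subgroup of the image of the restriction
`r_v : H¹(H, A) → H¹(H ∩ I_v, A)` (`hloc`), then

* **`zpCorank_quotient_le_sum`**: `corank_{ℤ_p}(S^{S₀}/S) ≤ Σ_{v∈S₀} N_v · c_v`.

Proof: the detecting map `Φ = (r_v ∘ conj_{γⁿ})_{v, n<N_v}` (as in n1011's
`DatumSelmerLocalIndexFinite`) has kernel `S` on `S^{S₀}`
(`forall_conjH1_mem_unramifiedKer_of_forall_lt`), so `S^{S₀}/S ≅ Φ(S^{S₀}) ↪ ∏_v ∏_{n<N_v} Y_{v,n}`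
with `Y_{v,n} = (r_v ∘ conj_{γⁿ})(S^{S₀}) ⊆ r_v(H¹(H, A))`, a `p`-primary group with finite
`p`-torsion (`finite_setOf_nsmul_eq_zero_discreteH1_inertiaIn`); the corank formula is monotone
under injections (`zpCorank_le_of_injective`) and additive over finite products (`zpCorank_pi`).
§1 is the pure `ℤ_p`-corank algebra (`zpCorank_le_of_injective`, `zpCorank_pi`,
`zpCorank_le_one_of_natCard_torsionBy_le`, `zpCorank_eq_zero_of_torsionBy_trivial`). The per-place
bounds `c_v ∈ {0, 1}` with `N_v c_v ≤ δ_E^{(v)}` at BAD places are the business of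
`LocalInertiaCohomology{Additive,Multiplicative,MultiplicativeVanishing}` and of the `ℚ`-level sequel.

References: [GreenbergVatsal2000] §2 pp. 16–17, 20–22 (Cor. (2.3), Prop. (2.4));
[GreenbergLNM1716] §1 p. 60; HOME X2-GAP.md §34.6.
-/

set_option autoImplicit false

noncomputable section

open scoped Classical AddSubgroup

open NumberField IsDedekindDomain Field CategoryTheory
open Literature.NumberTheory.GaloisRepresentations Literature.NumberTheory.EllipticCurves
  Literature.NumberTheory.EllipticCurves.GreenbergSelmer
  Literature.NumberTheory.EllipticCurves.GreenbergVatsal2000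
  Summit.BirchSwinnertonDyer.Rank1Residual.Iwasawa

universe u v w

namespace Summit.BirchSwinnertonDyer.Rank1Residual.X2.NonPrimitiveQuotientCorank

/-! ## §1. `ℤ_p`-corank algebra: monotonicity, products, small `p`-torsion -/

section Algebra

variable {p : ℕ} [hp : Fact p.Prime]

/-- **Monotonicity of the corank formula under injections** into a `p`-primary group with finite
`p`-torsion: `zpCorank A p ≤ zpCorank B p` for `A ↪ B` (additivity along `0 → A → B → B/A → 0`,
`zpCorank_eq_add_of_shortExact`). [cite: GreenbergLNM1716, §1 p. 60] -/
theorem zpCorank_le_of_injective {A : Type v} {B : Type w} [AddCommGroup A] [AddCommGroup B]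
    (f : A →+ B) (hf : Function.Injective f) (hB : ∀ b : B, ∃ n : ℕ, p ^ n • b = 0)
    [Finite (B[(p : ℤ)])] : zpCorank A p ≤ zpCorank B p := by
  have h := zpCorank_eq_add_of_shortExact (p := p) (i := f) (f := QuotientAddGroup.mk' f.range) hf
    (QuotientAddGroup.mk'_surjective _) (fun b hb ↦ (QuotientAddGroup.eq_zero_iff _).1 hb)
    (fun a ↦ (QuotientAddGroup.eq_zero_iff _).2 ⟨a, rfl⟩) hB
  omega

/-- `zpCorank A p ≤ dim_{𝔽_p} A[p]` (the formula subtracts `dim A/pA`). [folklore] -/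
theorem zpCorank_le_finrank {A : Type v} [AddCommGroup A] :
    letI : Module (ZMod p) (A[(p : ℤ)]) := AddSubgroup.torsionBy.zmodModule
    zpCorank A p ≤ Module.finrank (ZMod p) (A[(p : ℤ)]) := by
  unfold zpCorank
  exact Nat.sub_le _ _

/-- **`#A[p] ≤ p ⇒ zpCorank A p ≤ 1`** (`p^{dim A[p]} = #A[p]`). [folklore] -/
theorem zpCorank_le_one_of_natCard_torsionBy_le {A : Type v} [AddCommGroup A] [Finite (A[(p : ℤ)])]
    (h : Nat.card (A[(p : ℤ)]) ≤ p) : zpCorank A p ≤ 1 := by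
  letI : Module (ZMod p) (A[(p : ℤ)]) := AddSubgroup.torsionBy.zmodModule
  have hc := pow_finrank_eq_natCard (p := p) (A[(p : ℤ)])
  have h1 : Module.finrank (ZMod p) (A[(p : ℤ)]) ≤ 1 := by
    by_contra h2
    push Not at h2
    have h3 : p ^ 2 ≤ p ^ Module.finrank (ZMod p) (A[(p : ℤ)]) :=
      Nat.pow_le_pow_right hp.out.pos h2
    rw [hc] at h3
    have h4 : p < p ^ 2 := by
      rw [sq]; exact lt_mul_self hp.out.one_lt
    omega
  exact (zpCorank_le_finrank (p := p) (A := A)).trans h1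

/-- **No `p`-torsion ⇒ `zpCorank A p = 0`** (`A[p] = 0` has dimension `0`). [folklore] -/
theorem zpCorank_eq_zero_of_torsionBy_trivial {A : Type v} [AddCommGroup A]
    (h : ∀ a : A, p • a = 0 → a = 0) : zpCorank A p = 0 := by
  letI : Module (ZMod p) (A[(p : ℤ)]) := AddSubgroup.torsionBy.zmodModule
  haveI : Subsingleton (A[(p : ℤ)]) := by
    refine ⟨fun x y ↦ Subtype.ext ?_⟩
    rw [h x.1 (AddSubgroup.torsionBy.nsmul_iff.1 x.2), h y.1 (AddSubgroup.torsionBy.nsmul_iff.1 y.2)]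
  have h0 : Module.finrank (ZMod p) (A[(p : ℤ)]) = 0 := Module.finrank_zero_of_subsingleton
  have := zpCorank_le_finrank (p := p) (A := A)
  omega

omit hp in
/-- A finite product of `p`-primary groups is `p`-primary. [folklore] -/
theorem primary_pi {ι : Type u} [Finite ι] {Y : ι → Type v} [∀ i, AddCommGroup (Y i)]
    (hY : ∀ i (y : Y i), ∃ n : ℕ, p ^ n • y = 0) (y : ∀ i, Y i) : ∃ n : ℕ, p ^ n • y = 0 := by
  haveI := Fintype.ofFinite ι
  choose n hn using fun i ↦ hY i (y i)
  refine ⟨Finset.univ.sup n, funext fun i ↦ ?_⟩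
  have hle : n i ≤ Finset.univ.sup n := Finset.le_sup (Finset.mem_univ i)
  rw [Pi.smul_apply, Pi.zero_apply, ← Nat.sub_add_cancel hle, pow_add, mul_smul, hn, smul_zero]

omit hp in
/-- The `p`-torsion of a finite product of groups with finite `p`-torsion is finite. [folklore] -/
theorem finite_torsionBy_pi {ι : Type u} [Finite ι] {Y : ι → Type v} [∀ i, AddCommGroup (Y i)]
    [hfin : ∀ i, Finite ((Y i)[(p : ℤ)])] : Finite ((∀ i, Y i)[(p : ℤ)]) := by
  refine Finite.of_injective (fun y : (∀ i, Y i)[(p : ℤ)] ↦ fun i ↦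
    (⟨(y : ∀ i, Y i) i, AddSubgroup.torsionBy.nsmul_iff.2 ?_⟩ : (Y i)[(p : ℤ)])) ?_
  · have h := AddSubgroup.torsionBy.nsmul_iff.1 y.2
    exact (congrFun h i : (p • (y : ∀ i, Y i)) i = 0)
  · intro y z hyz
    apply Subtype.ext
    funext i
    exact congrArg (fun f : ∀ i, (Y i)[(p : ℤ)] ↦ ((f i : (Y i)[(p : ℤ)]) : Y i)) hyz

/-- **The corank formula is additive over finite products** of `p`-primary groups with finite
`p`-torsion: `zpCorank (∏ᵢ Yᵢ) p = Σᵢ zpCorank Yᵢ p` (induction on the index type through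
`Equiv.piOptionEquivProd` and `zpCorank_prod`). [cite: GreenbergLNM1716, §1 p. 60] -/
theorem zpCorank_pi {ι : Type u} [Fintype ι] {Y : ι → Type v} [∀ i, AddCommGroup (Y i)]
    (hY : ∀ i (y : Y i), ∃ n : ℕ, p ^ n • y = 0) [hfin : ∀ i, Finite ((Y i)[(p : ℤ)])] :
    zpCorank (∀ i, Y i) p = ∑ i, zpCorank (Y i) p := by
  -- induction on the finite index type
  have key : ∀ (α : Type u) [Fintype α] (Z : α → Type v) [∀ a, AddCommGroup (Z a)],
      (∀ a (z : Z a), ∃ n : ℕ, p ^ n • z = 0) → (∀ a, Finite ((Z a)[(p : ℤ)])) →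
      zpCorank (∀ a, Z a) p = ∑ a, zpCorank (Z a) p := by
    intro α hα
    refine @Fintype.induction_empty_option
      (fun (α : Type u) (_ : Fintype α) ↦ ∀ (Z : α → Type v) [∀ a, AddCommGroup (Z a)],
        (∀ a (z : Z a), ∃ n : ℕ, p ^ n • z = 0) → (∀ a, Finite ((Z a)[(p : ℤ)])) →
        zpCorank (∀ a, Z a) p = ∑ a, zpCorank (Z a) p) ?_ ?_ ?_ α hα
    · -- transport along `e : α ≃ β`
      intro α β _ e ih Z _ hZ hZfin
      letI : Fintype α := Fintype.ofEquiv β e.symm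
      haveI : ∀ a, Finite ((Z (e a))[(p : ℤ)]) := fun a ↦ hZfin (e a)
      have h1 := ih (fun a ↦ Z (e a)) (fun a z ↦ hZ (e a) z) (fun a ↦ hZfin (e a))
      have h2 : zpCorank (∀ a, Z (e a)) p = zpCorank (∀ b, Z b) p :=
        zpCorank_congr (LinearEquiv.piCongrLeft ℤ Z e).toAddEquiv p
      rw [← h2, h1]
      exact Fintype.sum_equiv e _ _ fun a ↦ rfl
    · -- the empty product is finite
      intro Z _ hZ hZfin
      haveI : Finite (∀ i : PEmpty.{u + 1}, Z i) := inferInstance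
      rw [zpCorank_of_finite_eq_zero, Fintype.sum_empty]
    · -- `Option α`: split off the factor at `none`
      intro α _ ih Z _ hZ hZfin
      haveI : ∀ o, Finite ((Z o)[(p : ℤ)]) := hZfin
      have h1 := ih (fun a ↦ Z (some a)) (fun a z ↦ hZ (some a) z) (fun a ↦ hZfin (some a))
      haveI : Finite ((∀ a : α, Z (some a))[(p : ℤ)]) := finite_torsionBy_pi
      have h2 : zpCorank (∀ o : Option α, Z o) p =
          zpCorank (Z none × (∀ a : α, Z (some a))) p :=
        zpCorank_congr (LinearEquiv.piOptionEquivProd ℤ (M := Z)).toAddEquiv p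
      rw [h2, zpCorank_prod (hZ none) (primary_pi fun a z ↦ hZ (some a) z), h1, Fintype.sum_option]
  exact key ι Y hY hfin

end Algebra

/-! ## §2. The corank of `S^{S₀}/S` from per-place bounds -/

section Quotient

variable {K : Type u} [Field K] [NumberField K] (W : WeierstrassCurve K) [W.IsElliptic]
  {p : ℕ} [Fact p.Prime] (κ : ZpExtension K p) {γ : absoluteGaloisGroup K}

/-- **`corank_{ℤ_p}(S^{S₀}_A(K_∞)/S_A(K_∞)) ≤ Σ_{v∈S₀} N_v · c_v`** for `A = E[p^∞]`, ANY Greenberg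
data `L`, and a finite set `S₀` of places `v ∤ p`, granted at each `v ∈ S₀`: the representative
property `Γ_K = H · D_v · {γⁿ : n < N_v}` (`hrep`) and a bound `c_v` on the corank formula of every
subgroup of the image of `r_v : H¹(H, A) → H¹(H ∩ I_v, A)` (`hloc`). This is the UPPER bound in
Greenberg–Vatsal's `corank S^{Σ₀}_A/S_A = Σ_{ℓ∈Σ₀} corank 𝓗_ℓ(ℚ_∞)`, `𝓗_ℓ = ∏_{η∣ℓ} H¹(I_η, A)^{G_η}`
(Cor. (2.3) with Prop. (2.4); the equality needs Prop. (2.1)): the detecting map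
`(r_v ∘ conj_{γⁿ})_{v∈S₀, n<N_v}` has kernel `S` on `S^{S₀}` and lands in `∏_v ∏_{n<N_v} Y_{v,n}`,
`Y_{v,n} = (r_v ∘ conj_{γⁿ})(S^{S₀})` (`p`-primary, finite `p`-torsion).
[cite: GreenbergVatsal2000, §2 pp. 17, 20–22] -/
theorem zpCorank_quotient_le_sum (L : Data K (W.geomPrimaryTorsion p) p)
    (S₀ : Finset (HeightOneSpectrum (𝓞 K))) (hS₀ : ∀ v ∈ S₀, ((p : ℕ) : 𝓞 K) ∉ v.asIdeal)
    (N c : HeightOneSpectrum (𝓞 K) → ℕ)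
    (hrep : ∀ v ∈ S₀, ∀ σ : absoluteGaloisGroup K, ∃ n < N v, ∃ δ ∈ decomp (K := K) v,
      ∃ h ∈ κ.kerSubgroup, σ = h * (δ * γ ^ n))
    (hloc : ∀ v ∈ S₀, ∀ Y : AddSubgroup (discreteH1 (inertiaIn κ.kerSubgroup v) (W.geomPrimaryTorsion p)),
      (∀ y ∈ Y, ∃ c : subgroupH1 κ.kerSubgroup (W.geomPrimaryTorsion p),
        resH1Hom (inertiaInToH κ.kerSubgroup v) (AddMonoidHom.id (W.geomPrimaryTorsion p))
          (fun _ _ ↦ rfl) c = y) →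
      zpCorank Y p ≤ c v) :
    zpCorank (↥(datumSelmerInfty κ (W.geomPrimaryTorsion p) L (↑S₀ : Set (HeightOneSpectrum (𝓞 K)))) ⧸
      (datumSelmerInfty κ (W.geomPrimaryTorsion p) L (∅ : Set (HeightOneSpectrum (𝓞 K)))).addSubgroupOf
        (datumSelmerInfty κ (W.geomPrimaryTorsion p) L (↑S₀ : Set (HeightOneSpectrum (𝓞 K))))) p ≤
      ∑ v ∈ S₀, N v * c v := by
  haveI : κ.kerSubgroup.Normal := by rw [ZpExtension.kerSubgroup]; infer_instance
  set H := κ.kerSubgroup with hH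
  set A := W.geomPrimaryTorsion p with hA
  set SS := datumSelmerInfty κ A L (↑S₀ : Set (HeightOneSpectrum (𝓞 K))) with hSS
  set S := datumSelmerInfty κ A L (∅ : Set (HeightOneSpectrum (𝓞 K))) with hS
  let ι := ↥S₀
  -- the detecting map
  let Φ : W.subgroupH1 p H →+ (Π i : ι, Fin (N i.1) → discreteH1 (inertiaIn H i.1) A) :=
    AddMonoidHom.pi fun i ↦ AddMonoidHom.pi fun n ↦
      (resH1Hom (inertiaInToH H i.1) (AddMonoidHom.id A) fun _ _ ↦ rfl).comp
        (conjH1 H A (γ ^ (n : ℕ)))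
  have hΦ : ∀ (x : W.subgroupH1 p H) (i : ι) (n : Fin (N i.1)),
      Φ x i n = resH1Hom (inertiaInToH H i.1) (AddMonoidHom.id A) (fun _ _ ↦ rfl)
        (conjH1 H A (γ ^ (n : ℕ)) x) := fun _ _ _ ↦ rfl
  let φ : SS →+ (Π i : ι, Fin (N i.1) → discreteH1 (inertiaIn H i.1) A) := Φ.comp SS.subtype
  -- (a) the kernel of `φ` is `S`
  have hker : ∀ s : SS, φ s = 0 ↔ (s : W.subgroupH1 p H) ∈ S := by
    intro s
    constructor
    · intro h0
      rw [hS, mem_datumSelmerInfty_empty_iff κ A L (↑S₀ : Set _)]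
      refine ⟨s.2, fun v hv hpv σ ↦ ?_⟩
      refine forall_conjH1_mem_unramifiedKer_of_forall_lt κ A
        (hrep v (Finset.mem_coe.1 hv)) (fun n hn ↦ ?_) σ
      have h := congrFun (congrFun h0 ⟨v, Finset.mem_coe.1 hv⟩) ⟨n, hn⟩
      rw [show φ s ⟨v, Finset.mem_coe.1 hv⟩ ⟨n, hn⟩ = Φ (s : W.subgroupH1 p H) ⟨v, _⟩ ⟨n, hn⟩
        from rfl, hΦ] at h
      exact h
    · intro hs
      funext i n
      rw [show φ s i n = Φ (s : W.subgroupH1 p H) i n from rfl, hΦ]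
      exact ((mem_datumSelmerInfty_empty_iff κ A L (↑S₀ : Set _) _).1 hs).2 i.1
        (Finset.mem_coe.2 i.2) (hS₀ i.1 i.2) (γ ^ (n : ℕ))
  have hkerEq : φ.ker = S.addSubgroupOf SS := by
    ext s
    rw [AddMonoidHom.mem_ker, AddSubgroup.mem_addSubgroupOf]
    exact hker s
  -- (b) `SS/S ≅ range φ`
  have hcongr : zpCorank (↥SS ⧸ S.addSubgroupOf SS) p = zpCorank φ.range p := by
    refine zpCorank_congr ?_ p
    exact (QuotientAddGroup.quotientAddEquivOfEq hkerEq).symm.trans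
      (QuotientAddGroup.quotientKerEquivRange φ)
  rw [hcongr]
  -- (c) the images `Y_{v,n}` and the product `B`
  let Yv : ∀ i : ι, Fin (N i.1) → AddSubgroup (discreteH1 (inertiaIn H i.1) A) := fun i n ↦
    (((resH1Hom (inertiaInToH H i.1) (AddMonoidHom.id A) fun _ _ ↦ rfl).comp
      (conjH1 H A (γ ^ (n : ℕ)))).comp SS.subtype).range
  have hYprim : ∀ (i : ι) (n : Fin (N i.1)) (y : Yv i n), ∃ k : ℕ, p ^ k • y = 0 := by
    rintro i n ⟨_, ⟨s, rfl⟩⟩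
    obtain ⟨k, hk⟩ := W.exists_pow_smul_subgroupH1_ker_eq_zero κ (s : W.subgroupH1 p H)
    refine ⟨k, Subtype.ext ?_⟩
    change p ^ k • ((resH1Hom (inertiaInToH H i.1) (AddMonoidHom.id A) fun _ _ ↦ rfl)
      (conjH1 H A (γ ^ (n : ℕ)) (s : W.subgroupH1 p H))) = 0
    rw [← map_nsmul, ← map_nsmul, hk, map_zero, map_zero]
  have hYfin : ∀ (i : ι) (n : Fin (N i.1)), Finite ((↥(Yv i n))[(p : ℤ)]) := by
    intro i n
    have hfin := finite_setOf_nsmul_eq_zero_discreteH1_inertiaIn W κ i.1 (hS₀ i.1 i.2)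
    haveI := hfin.to_subtype
    refine Finite.of_injective (fun y : (↥(Yv i n))[(p : ℤ)] ↦
      (⟨((y : Yv i n) : discreteH1 (inertiaIn H i.1) A), ?_⟩ :
        {x : discreteH1 (inertiaIn H i.1) A | p • x = 0})) ?_
    · have h := AddSubgroup.torsionBy.nsmul_iff.1 y.2
      change p • ((y : Yv i n) : discreteH1 (inertiaIn H i.1) A) = 0
      rw [← AddSubmonoidClass.coe_nsmul, h, ZeroMemClass.coe_zero]
    · intro y z hyz
      have h := congrArg Subtype.val hyz
      exact Subtype.ext (Subtype.ext h)
  -- inner and outer products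
  have hinner : ∀ i : ι, zpCorank (∀ n : Fin (N i.1), Yv i n) p ≤ N i.1 * c i.1 := by
    intro i
    haveI : ∀ n : Fin (N i.1), Finite ((↥(Yv i n))[(p : ℤ)]) := hYfin i
    rw [zpCorank_pi (hYprim i)]
    calc ∑ n : Fin (N i.1), zpCorank (Yv i n) p ≤ ∑ _n : Fin (N i.1), c i.1 :=
          Finset.sum_le_sum fun n _ ↦ hloc i.1 i.2 (Yv i n) (by
            rintro _ ⟨s, rfl⟩
            exact ⟨conjH1 H A (γ ^ (n : ℕ)) (s : W.subgroupH1 p H), rfl⟩)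
      _ = N i.1 * c i.1 := by rw [Finset.sum_const, Finset.card_univ, Fintype.card_fin, smul_eq_mul]
  have hBprim : ∀ b : (∀ i : ι, ∀ n : Fin (N i.1), Yv i n), ∃ k : ℕ, p ^ k • b = 0 :=
    primary_pi fun i ↦ primary_pi (hYprim i)
  haveI hBfin : Finite ((∀ i : ι, ∀ n : Fin (N i.1), Yv i n)[(p : ℤ)]) := by
    haveI : ∀ i : ι, Finite ((∀ n : Fin (N i.1), Yv i n)[(p : ℤ)]) := fun i ↦ by
      haveI : ∀ n : Fin (N i.1), Finite ((↥(Yv i n))[(p : ℤ)]) := hYfin i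
      exact finite_torsionBy_pi
    exact finite_torsionBy_pi
  -- (d) `range φ ↪ B`
  let j : φ.range →+ (∀ i : ι, ∀ n : Fin (N i.1), Yv i n) :=
    { toFun := fun y ↦ fun i n ↦ ⟨(y : ∀ i : ι, Fin (N i.1) → discreteH1 (inertiaIn H i.1) A) i n, by
        obtain ⟨s, hs⟩ := y.2
        exact ⟨s, congrFun (congrFun hs i) n⟩⟩
      map_zero' := by funext i n; rfl
      map_add' := fun y z ↦ by funext i n; rfl }
  have hj : Function.Injective j := by
    intro y z hyz
    apply Subtype.ext
    funext i n
    have h := congrArg (fun f : (∀ i : ι, ∀ n : Fin (N i.1), Yv i n) ↦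
      ((f i n : Yv i n) : discreteH1 (inertiaIn H i.1) A)) hyz
    exact h
  calc zpCorank φ.range p ≤ zpCorank (∀ i : ι, ∀ n : Fin (N i.1), Yv i n) p :=
        zpCorank_le_of_injective j hj hBprim
    _ = ∑ i : ι, zpCorank (∀ n : Fin (N i.1), Yv i n) p := by
        haveI : ∀ i : ι, Finite ((∀ n : Fin (N i.1), Yv i n)[(p : ℤ)]) := fun i ↦ by
          haveI : ∀ n : Fin (N i.1), Finite ((↥(Yv i n))[(p : ℤ)]) := hYfin i
          exact finite_torsionBy_pi
        exact zpCorank_pi fun i ↦ primary_pi (hYprim i)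
    _ ≤ ∑ i : ι, N i.1 * c i.1 := Finset.sum_le_sum fun i _ ↦ hinner i
    _ = ∑ v ∈ S₀, N v * c v := Finset.sum_coe_sort S₀ (fun v ↦ N v * c v)

end Quotient

end Summit.BirchSwinnertonDyer.Rank1Residual.X2.NonPrimitiveQuotientCorank

end
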